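import Literature.Analysis.FluidPDE.PeriodicLerayProfileBounds
import Literature.Analysis.FluidPDE.PeriodicLerayPairingTools
import HarnessLib

/-!
# [BT1] Lemma 2.5, discharge III: the pairing `⟨LW, ζ⟩` of the revised profile — reduction by
# the weak equation `LU₀ = 0` and the `H⁻¹` bound

Analysis/FluidPDE proof file (theorems only), third part of the discharge of the named fact
`Literature.Analysis.FluidPDE.bradshawTsai2017_lemma_2_5` (`PeriodicLerayExistence.lean`;
Bradshaw–Tsai, Ann. Henri Poincaré 18 (2017) = arXiv:1510.07504 [BT1], Lemma 2.5, the bound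
"`‖LW‖_{L^∞(0,T;H⁻¹(ℝ³))} ≤ c(R₀,U₀)`"). The printed proof: "Note that `LW = L(ξU₀) + Lw`. …
The estimates [`‖∂ₛw‖_{L²}`, `‖w‖_{L²}`, `|∇w| ≤ C/(1+|y|³)`] show that `Lw ∈ L^∞(0,T;H⁻¹)`. We
now focus on `L(ξU₀)`. Note that, because `LU₀ = 0` by Assumption 2.1,
`L(ξU₀) = ξLU₀ + W₂ = W₂`, where `W₂ = −(Δξ)U₀ − 2(∇ξ·∇)U₀ − (y·∇ξ)U₀`. Since both `U₀` and `∇U₀`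
belong to `L^∞_loc` and `∇ξ` is compactly supported, `sup_s ‖W₂(·,s)‖_{L¹∩L^∞} ≤ C`."

In the tree `LU₀ = 0` holds in the weak form (2.3) (`ProfileAssumption.leray`, `U₀` being only
`C¹`), so the commutator is computed in weak form: testing the equation of `U₀` with `ξζ`
(`ζ` a test field) and subtracting,

  `⟨LW(s), ζ⟩ = ∫ ⟪F(s), ζ⟫ + ∑ᵢ ∫ ⟪Hᵢ(s), ∂ᵢζ⟫`,
  `F = ∂ₛw − w − (y·∇ξ)U₀ − (y·∇)w − ∑ᵢ (∂ᵢξ) ∂ᵢU₀`,  `Hᵢ = (∂ᵢξ)U₀ + ∂ᵢw`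

(`lerayPairing_revisedProfile_eq`; the pointwise algebra is `pairing_pointwise`). Consequently
(`abs_lerayPairing_revisedProfile_le`) `|⟨LW(s), ζ⟩| ≤ c ‖ζ‖_{H¹}` as soon as `∂ₛw(s)`, `w(s)` are
in `L²` and the remaining terms are dominated by a square-integrable weight — the inputs
supplied, uniformly in `s`, by `PeriodicLerayProfileBounds.lean` and the periodic sup bounds.

## References

* Z. Bradshaw, T.-P. Tsai, Ann. Henri Poincaré 18 (2017) = arXiv:1510.07504, proof of Lemma 2.5
  (the estimates for `Lw` and `L(ξU₀) = W₂`) [BradshawTsai2017AHP].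
-/

noncomputable section

open MeasureTheory Set Function Filter Topology TopologicalSpace Metric InnerProductSpace
open scoped NNReal ENNReal RealInnerProductSpace Convolution

namespace Literature.Analysis.FluidPDE

namespace BradshawTsai2017

open NewtonGradPotential

/-! ### The pointwise algebra of the commutator -/

/-- **The commutator identity, pointwise.** With `W = ξU₀ + w`, `∂ₛW = ξV + wₜ`,
`DW = ξ DU + dξ ⊗ U + Dw` and the test field `φ = ξζ`, `Dφ = ξ Dζ + dξ ⊗ ζ`, the integrand of
`⟨LW, ζ⟩` equals the integrand of `⟨LU₀, ξζ⟩` (with `∂ₛU₀ = V`) plus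
`⟪wₜ − w − (dξ y)U − Dw y − ∑ᵢ(dξ eᵢ)DU eᵢ, ζ⟫ + ∑ᵢ ⟪(dξ eᵢ)U + Dw eᵢ, Dζ eᵢ⟫`. [cite: BradshawTsai2017AHP, proof of Lemma 2.5] -/
theorem pairing_pointwise {ι : Type*} [Fintype ι] (b : ι → EuclideanSpace ℝ (Fin 3)) (ξy : ℝ)
    (dξ : EuclideanSpace ℝ (Fin 3) →L[ℝ] ℝ) (V U wt w ζ y : EuclideanSpace ℝ (Fin 3))
    (DU Dw Dζ : EuclideanSpace ℝ (Fin 3) →L[ℝ] EuclideanSpace ℝ (Fin 3)) :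
    ⟪(ξy • V + wt) - (ξy • U + w) - (ξy • DU y + dξ y • U + Dw y), ζ⟫ +
        ∑ i, ⟪ξy • DU (b i) + dξ (b i) • U + Dw (b i), Dζ (b i)⟫ =
      (⟪V - U - DU y, ξy • ζ⟫ + ∑ i, ⟪DU (b i), ξy • Dζ (b i) + dξ (b i) • ζ⟫) +
      (⟪wt - w - dξ y • U - Dw y - ∑ i, dξ (b i) • DU (b i), ζ⟫ +
        ∑ i, ⟪dξ (b i) • U + Dw (b i), Dζ (b i)⟫) := by
  simp only [inner_add_left, inner_sub_left, inner_add_right, real_inner_smul_left,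
    real_inner_smul_right, sum_inner, Finset.sum_add_distrib]
  ring

/-! ### Derivatives of `ξ_R U₀(s)`, of `W(s)` and of the test field `ξ_R ζ` -/

variable {U₀ : ℝ → EuclideanSpace ℝ (Fin 3) → EuclideanSpace ℝ (Fin 3)} {R : ℝ}

/-- `D(ξ_R u)(y) h = ξ_R(y) Du(y) h + (Dξ_R(y) h) u(y)` for a `C¹` field `u`. [folklore] -/
theorem fderiv_cutoffScaled_smul_apply' {u : EuclideanSpace ℝ (Fin 3) → EuclideanSpace ℝ (Fin 3)}
    (hu : ContDiff ℝ 1 u) (R : ℝ) (y h : EuclideanSpace ℝ (Fin 3)) :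
    fderiv ℝ (fun y => cutoffScaled R y • u y) y h =
      cutoffScaled R y • fderiv ℝ u y h + (fderiv ℝ (cutoffScaled R) y h) • u y := by
  rw [fderiv_fun_smul ((contDiff_cutoffScaled R (n := 1)).differentiable one_ne_zero y)
    (hu.differentiable one_ne_zero y)]
  simp only [_root_.add_apply, _root_.FunLike.coe_smul, Pi.smul_apply,
    ContinuousLinearMap.smulRight_apply]

/-- `DW(s)(y) h = ξ_R(y) DU₀(s)(y) h + (Dξ_R(y) h) U₀(s,y) + Dw(s)(y) h`. [cite: BradshawTsai2017AHP, Lemma 2.5] -/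
theorem fderiv_revisedProfile_apply (hU : ContDiff ℝ 1 (uncurry U₀)) (hR : 0 < R) (s : ℝ)
    (y h : EuclideanSpace ℝ (Fin 3)) :
    fderiv ℝ (revisedProfile R U₀ s) y h =
      cutoffScaled R y • fderiv ℝ (U₀ s) y h + (fderiv ℝ (cutoffScaled R) y h) • U₀ s y +
        fderiv ℝ (profileCorrector R U₀ s) y h := by
  rw [(hasFDerivAt_revisedProfile hU hR s y).fderiv, _root_.add_apply,
    fderiv_cutoffScaled_smul_apply' (contDiff_profileSlice hU s) R y h]

/-- The cut-off test field `ξ_R ζ` is a test field. [folklore] -/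
theorem isTestFunctionOn_cutoffScaled_smul (R : ℝ)
    {ζ : EuclideanSpace ℝ (Fin 3) → EuclideanSpace ℝ (Fin 3)}
    (hζ : FunctionSpaces.IsTestFunctionOn (⊤ : Opens (EuclideanSpace ℝ (Fin 3))) ζ) :
    FunctionSpaces.IsTestFunctionOn (⊤ : Opens (EuclideanSpace ℝ (Fin 3)))
      fun y => cutoffScaled R y • ζ y := by
  have h1 : ContDiff ℝ ((⊤ : ℕ∞) : WithTop ℕ∞) (cutoffScaled R) := contDiff_cutoffScaled R
  refine ⟨h1.smul hζ.contDiff, ?_, fun _ _ => trivial⟩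
  exact HasCompactSupport.intro hζ.hasCompactSupport fun y hy => by
    rw [image_eq_zero_of_notMem_tsupport hy, smul_zero]

/-! ### Integrability of pairings with test fields -/

/-- A continuous integrand vanishing off the topological support of a compactly supported
`ζ` is integrable. [folklore] -/
theorem integrable_of_eq_zero_off_tsupport {f : EuclideanSpace ℝ (Fin 3) → ℝ}
    {ζ : EuclideanSpace ℝ (Fin 3) → EuclideanSpace ℝ (Fin 3)} (hf : Continuous f)
    (hζc : HasCompactSupport ζ) (h : ∀ y, y ∉ tsupport ζ → f y = 0) : Integrable f volume :=
  hf.integrable_of_hasCompactSupport (HasCompactSupport.intro hζc fun y hy => h y hy)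

/-- Off the support of a test field, the field and its derivative vanish. [folklore] -/
theorem apply_and_fderiv_eq_zero_of_notMem_tsupport
    {ζ : EuclideanSpace ℝ (Fin 3) → EuclideanSpace ℝ (Fin 3)} {y : EuclideanSpace ℝ (Fin 3)}
    (hy : y ∉ tsupport ζ) : ζ y = 0 ∧ fderiv ℝ ζ y = 0 :=
  ⟨image_eq_zero_of_notMem_tsupport hy,
    image_eq_zero_of_notMem_tsupport fun h => hy (tsupport_fderiv_subset ℝ h)⟩

/-! ### The pairing identity -/

/-- **`⟨LW(s), ζ⟩ = ∫ ⟪F(s), ζ⟫ + ∑ᵢ ∫ ⟪Hᵢ(s), ∂ᵢζ⟫`** for `W = revisedProfile R U₀`: the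
pairing of the Leray operator of `W = ξU₀ + w` against a test field `ζ`, reduced by the weak
equation `⟨LU₀, ξζ⟩ = 0` (Assumption 2.1 in the form (2.3)) to the commutator terms
`F = ∂ₛw − w − (y·∇ξ)U₀ − (y·∇)w − ∑ᵢ(∂ᵢξ)∂ᵢU₀` and `Hᵢ = (∂ᵢξ)U₀ + ∂ᵢw` ([BT1]:
"`L(ξU₀) = ξLU₀ + W₂ = W₂`", here in weak form, together with `Lw`). [cite: BradshawTsai2017AHP, proof of Lemma 2.5] -/
theorem lerayPairing_revisedProfile_eq (hU : ContDiff ℝ 1 (uncurry U₀))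
    (hleray : ∀ s, ∀ φ : EuclideanSpace ℝ (Fin 3) → EuclideanSpace ℝ (Fin 3),
      FunctionSpaces.IsTestFunctionOn (⊤ : Opens (EuclideanSpace ℝ (Fin 3))) φ →
      ∫ y, (⟪timeDeriv U₀ s y - U₀ s y - fderiv ℝ (U₀ s) y y, φ y⟫ +
        frobeniusInner (fderiv ℝ (U₀ s) y) (fderiv ℝ φ y)) = 0)
    (hR : 0 < R) (s : ℝ) {ζ : EuclideanSpace ℝ (Fin 3) → EuclideanSpace ℝ (Fin 3)}
    (hζ : FunctionSpaces.IsTestFunctionOn (⊤ : Opens (EuclideanSpace ℝ (Fin 3))) ζ) :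
    lerayPairing (revisedProfile R U₀) s ζ =
      (∫ y, ⟪timeDeriv (profileCorrector R U₀) s y - profileCorrector R U₀ s y -
          (fderiv ℝ (cutoffScaled R) y y) • U₀ s y -
          fderiv ℝ (profileCorrector R U₀ s) y y -
          ∑ i, (fderiv ℝ (cutoffScaled R) y (stdOrthonormalBasis ℝ (EuclideanSpace ℝ (Fin 3)) i)) •
            fderiv ℝ (U₀ s) y (stdOrthonormalBasis ℝ (EuclideanSpace ℝ (Fin 3)) i), ζ y⟫) +
      ∑ i, ∫ y, ⟪(fderiv ℝ (cutoffScaled R) y (stdOrthonormalBasis ℝ (EuclideanSpace ℝ (Fin 3)) i)) •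
            U₀ s y +
          fderiv ℝ (profileCorrector R U₀ s) y (stdOrthonormalBasis ℝ (EuclideanSpace ℝ (Fin 3)) i),
          fderiv ℝ ζ y (stdOrthonormalBasis ℝ (EuclideanSpace ℝ (Fin 3)) i)⟫ := by
  set b := stdOrthonormalBasis ℝ (EuclideanSpace ℝ (Fin 3)) with hb
  set ξ : EuclideanSpace ℝ (Fin 3) → ℝ := cutoffScaled R with hξ
  set w : ℝ → EuclideanSpace ℝ (Fin 3) → EuclideanSpace ℝ (Fin 3) := profileCorrector R U₀ with hw
  set V : EuclideanSpace ℝ (Fin 3) → EuclideanSpace ℝ (Fin 3) := fun y =>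
    fderiv ℝ (uncurry U₀) (s, y) (1, 0) with hV
  set φ : EuclideanSpace ℝ (Fin 3) → EuclideanSpace ℝ (Fin 3) := fun y => ξ y • ζ y with hφ
  have hφt := isTestFunctionOn_cutoffScaled_smul R hζ
  -- continuity of the pieces
  have hUc : Continuous (U₀ s) := (contDiff_profileSlice hU s).continuous
  have hDUc : Continuous (fderiv ℝ (U₀ s)) :=
    (contDiff_profileSlice hU s).continuous_fderiv one_ne_zero
  have hVc : Continuous V :=
    ((hU.continuous_fderiv one_ne_zero).clm_apply continuous_const).comp
      (continuous_const.prodMk continuous_id)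
  have hWj : ContDiff ℝ 1 (uncurry (revisedProfile R U₀)) := contDiff_uncurry_revisedProfile hU hR
  have hwj : ContDiff ℝ 1 (uncurry w) := by
    have e : uncurry w = uncurry (revisedProfile R U₀) - uncurry fun s y => ξ y • U₀ s y := by
      funext p
      simp only [hw, uncurry_def, Pi.sub_apply, revisedProfile_apply, hξ]
      abel
    rw [e]
    exact hWj.sub (contDiff_cutoffScaled_smul hU R)
  have hwc : Continuous (w s) := (contDiff_profileSlice hwj s).continuous
  have hDwc : Continuous (fderiv ℝ (w s)) :=
    (contDiff_profileSlice hwj s).continuous_fderiv one_ne_zero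
  have hwtc : Continuous (timeDeriv w s) := by
    have e : timeDeriv w s = fun y => fderiv ℝ (uncurry w) (s, y) (1, 0) :=
      funext fun y => timeDeriv_profile hwj s y
    rw [e]
    exact ((hwj.continuous_fderiv one_ne_zero).clm_apply continuous_const).comp
      (continuous_const.prodMk continuous_id)
  have hξc : Continuous ξ := (contDiff_cutoffScaled R (n := 0)).continuous
  have hdξc : Continuous (fderiv ℝ ξ) := continuous_fderiv_cutoffScaled R
  have hζc' : Continuous ζ := hζ.contDiff.continuous
  have hDζc : Continuous (fderiv ℝ ζ) := hζ.contDiff.continuous_fderiv (by simp)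
  -- pointwise formulas
  have hT : ∀ y, timeDeriv (revisedProfile R U₀) s y = ξ y • V y + timeDeriv w s y := fun y =>
    timeDeriv_revisedProfile hU hR s y
  have hTU : ∀ y, timeDeriv U₀ s y = V y := fun y => timeDeriv_profile hU s y
  have hDW : ∀ y h, fderiv ℝ (revisedProfile R U₀ s) y h =
      ξ y • fderiv ℝ (U₀ s) y h + (fderiv ℝ ξ y h) • U₀ s y + fderiv ℝ (w s) y h := fun y h =>
    fderiv_revisedProfile_apply hU hR s y h
  have hDφ : ∀ y h, fderiv ℝ φ y h = ξ y • fderiv ℝ ζ y h + (fderiv ℝ ξ y h) • ζ y := fun y h =>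
    fderiv_cutoffScaled_smul_apply' (hζ.contDiff.of_le (mod_cast le_top)) R y h
  -- the three integrands
  set Lφ : EuclideanSpace ℝ (Fin 3) → ℝ := fun y =>
    ⟪timeDeriv U₀ s y - U₀ s y - fderiv ℝ (U₀ s) y y, φ y⟫ +
      frobeniusInner (fderiv ℝ (U₀ s) y) (fderiv ℝ φ y) with hLφ
  set E₁ : EuclideanSpace ℝ (Fin 3) → ℝ := fun y =>
    ⟪timeDeriv w s y - w s y - (fderiv ℝ ξ y y) • U₀ s y - fderiv ℝ (w s) y y -
      ∑ i, (fderiv ℝ ξ y (b i)) • fderiv ℝ (U₀ s) y (b i), ζ y⟫ with hE₁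
  set E₂ : Fin (Module.finrank ℝ (EuclideanSpace ℝ (Fin 3))) → EuclideanSpace ℝ (Fin 3) → ℝ :=
    fun i y => ⟪(fderiv ℝ ξ y (b i)) • U₀ s y + fderiv ℝ (w s) y (b i), fderiv ℝ ζ y (b i)⟫
    with hE₂
  -- Step A: the pointwise identity
  have key : ∀ y, ⟪timeDeriv (revisedProfile R U₀) s y - revisedProfile R U₀ s y -
        fderiv ℝ (revisedProfile R U₀ s) y y, ζ y⟫ +
      frobeniusInner (fderiv ℝ (revisedProfile R U₀ s) y) (fderiv ℝ ζ y) =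
      Lφ y + (E₁ y + ∑ i, E₂ i y) := by
    intro y
    simp only [hLφ, hE₁, hE₂, frobeniusInner, hT y, hTU y, hDW y, hDφ y, revisedProfile_apply,
      ← hb]
    exact pairing_pointwise (fun i => b i) (ξ y) (fderiv ℝ ξ y) (V y) (U₀ s y) (timeDeriv w s y)
      (w s y) (ζ y) y (fderiv ℝ (U₀ s) y) (fderiv ℝ (w s) y) (fderiv ℝ ζ y)
  -- Step B: integrability
  have hζcs := hζ.hasCompactSupport
  have hTU' : timeDeriv U₀ s = V := funext hTU
  have hφc : Continuous φ := hφt.contDiff.continuous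
  have hDφc : Continuous (fderiv ℝ φ) := hφt.contDiff.continuous_fderiv (by simp)
  have hLφi : Integrable Lφ volume := by
    refine integrable_of_eq_zero_off_tsupport ?_ hζcs fun y hy => ?_
    · simp only [hLφ, hTU', frobeniusInner]
      refine Continuous.add ?_ (continuous_finsetSum _ fun i _ => ?_)
      · exact ((hVc.sub hUc).sub (hDUc.clm_apply continuous_id)).inner hφc
      · exact (hDUc.clm_apply continuous_const).inner (hDφc.clm_apply continuous_const)
    · obtain ⟨h0, h1⟩ := apply_and_fderiv_eq_zero_of_notMem_tsupport hy
      have hφy : φ y = 0 := by simp only [hφ, h0, smul_zero]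
      have hDφy : ∀ h, fderiv ℝ φ y h = 0 := fun h => by
        rw [hDφ y h, h0, h1, smul_zero, _root_.zero_apply, smul_zero, add_zero]
      simp only [hLφ, frobeniusInner, hφy, hDφy, inner_zero_right, Finset.sum_const_zero, add_zero]
  have hE₁i : Integrable E₁ volume := by
    refine integrable_of_eq_zero_off_tsupport ?_ hζcs fun y hy => ?_
    · simp only [hE₁]
      refine Continuous.inner ?_ hζc'
      refine (((hwtc.sub hwc).sub ((hdξc.clm_apply continuous_id).smul hUc)).sub
        (hDwc.clm_apply continuous_id)).sub (continuous_finsetSum _ fun i _ => ?_)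
      exact (hdξc.clm_apply continuous_const).smul (hDUc.clm_apply continuous_const)
    · simp only [hE₁, (apply_and_fderiv_eq_zero_of_notMem_tsupport hy).1, inner_zero_right]
  have hE₂i : ∀ i, Integrable (E₂ i) volume := by
    intro i
    refine integrable_of_eq_zero_off_tsupport ?_ hζcs fun y hy => ?_
    · simp only [hE₂]
      exact (((hdξc.clm_apply continuous_const).smul hUc).add
        (hDwc.clm_apply continuous_const)).inner (hDζc.clm_apply continuous_const)
    · simp only [hE₂, (apply_and_fderiv_eq_zero_of_notMem_tsupport hy).2,
        _root_.zero_apply, inner_zero_right]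
  -- Step C: integrate
  have hzero : ∫ y, Lφ y = 0 := hleray s φ hφt
  have hsum : Integrable (fun y => ∑ i, E₂ i y) volume := integrable_finsetSum _ fun i _ => hE₂i i
  have h12 : Integrable (fun y => E₁ y + ∑ i, E₂ i y) volume := hE₁i.add hsum
  calc lerayPairing (revisedProfile R U₀) s ζ = ∫ y, (Lφ y + (E₁ y + ∑ i, E₂ i y)) := by
        rw [lerayPairing]
        exact integral_congr_ae (Eventually.of_forall key)
    _ = (∫ y, Lφ y) + ((∫ y, E₁ y) + ∫ y, ∑ i, E₂ i y) := by
        rw [integral_add hLφi h12, integral_add hE₁i hsum]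
    _ = (∫ y, E₁ y) + ∑ i, ∫ y, E₂ i y := by
        rw [hzero, zero_add, integral_finsetSum _ fun i _ => hE₂i i]

/-! ### The `H⁻¹` bound -/

/-- **`|⟨LW(s), ζ⟩| ≤ c ‖ζ‖_{H¹}`** from `L²` inputs. Suppose, for the slice `s` of
`W = revisedProfile R U₀`: `‖∂ₛw(s)‖_{L²} ≤ Bₜ`, `‖w(s)‖_{L²} ≤ B_w`, and the pointwise
dominations `‖(y·∇ξ)U₀ + (y·∇)w + ∑ᵢ(∂ᵢξ)∂ᵢU₀‖ ≤ K₁ ρ`, `‖(∂ᵢξ)U₀ + ∂ᵢw‖ ≤ K₂ ρ` by the weight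
`ρ(y) = (1+|y|)⁻²` (`‖ρ‖_{L²} =: B_ρ < ∞`). Then for every test field `ζ`,
`|⟨LW(s), ζ⟩| ≤ (Bₜ + B_w + K₁B_ρ + 3K₂B_ρ) ‖ζ‖_{H¹}` ([BT1]: "The estimates (`∂ₛw`), (`w`), and
(`∇w`) show that `Lw ∈ L^∞(0,T;H⁻¹)` … `sup_s ‖W₂(·,s)‖_{L¹∩L^∞} ≤ C`"). [cite: BradshawTsai2017AHP, proof of Lemma 2.5] -/
theorem abs_lerayPairing_revisedProfile_le (hU : ContDiff ℝ 1 (uncurry U₀))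
    (hleray : ∀ s, ∀ φ : EuclideanSpace ℝ (Fin 3) → EuclideanSpace ℝ (Fin 3),
      FunctionSpaces.IsTestFunctionOn (⊤ : Opens (EuclideanSpace ℝ (Fin 3))) φ →
      ∫ y, (⟪timeDeriv U₀ s y - U₀ s y - fderiv ℝ (U₀ s) y y, φ y⟫ +
        frobeniusInner (fderiv ℝ (U₀ s) y) (fderiv ℝ φ y)) = 0)
    (hR : 0 < R) (s : ℝ) {Bt Bw K₁ K₂ Bρ : ℝ} (hBt : 0 ≤ Bt) (hBw : 0 ≤ Bw) (hK₁ : 0 ≤ K₁)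
    (hK₂ : 0 ≤ K₂)
    (hρ : eLpNorm (fun y : EuclideanSpace ℝ (Fin 3) => ((1 + ‖y‖) ^ 2)⁻¹) 2 volume ≤
      ENNReal.ofReal Bρ) (hBρ : 0 ≤ Bρ)
    (h_t : eLpNorm (timeDeriv (profileCorrector R U₀) s) 2 volume ≤ ENNReal.ofReal Bt)
    (h_w : eLpNorm (profileCorrector R U₀ s) 2 volume ≤ ENNReal.ofReal Bw)
    (h₁ : ∀ y, ‖(fderiv ℝ (cutoffScaled R) y y) • U₀ s y +
        fderiv ℝ (profileCorrector R U₀ s) y y +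
        ∑ i, (fderiv ℝ (cutoffScaled R) y (stdOrthonormalBasis ℝ (EuclideanSpace ℝ (Fin 3)) i)) •
          fderiv ℝ (U₀ s) y (stdOrthonormalBasis ℝ (EuclideanSpace ℝ (Fin 3)) i)‖ ≤
        K₁ * ((1 + ‖y‖) ^ 2)⁻¹)
    (h₂ : ∀ i y, ‖(fderiv ℝ (cutoffScaled R) y (stdOrthonormalBasis ℝ (EuclideanSpace ℝ (Fin 3)) i)) •
          U₀ s y +
        fderiv ℝ (profileCorrector R U₀ s) y (stdOrthonormalBasis ℝ (EuclideanSpace ℝ (Fin 3)) i)‖ ≤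
        K₂ * ((1 + ‖y‖) ^ 2)⁻¹)
    {ζ : EuclideanSpace ℝ (Fin 3) → EuclideanSpace ℝ (Fin 3)}
    (hζ : FunctionSpaces.IsTestFunctionOn (⊤ : Opens (EuclideanSpace ℝ (Fin 3))) ζ) :
    |lerayPairing (revisedProfile R U₀) s ζ| ≤ (Bt + Bw + K₁ * Bρ + 3 * (K₂ * Bρ)) * h1Norm ζ := by
  rw [lerayPairing_revisedProfile_eq hU hleray hR s hζ]
  set b := stdOrthonormalBasis ℝ (EuclideanSpace ℝ (Fin 3)) with hb
  set w : ℝ → EuclideanSpace ℝ (Fin 3) → EuclideanSpace ℝ (Fin 3) := profileCorrector R U₀ with hw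
  -- measurability of the slices (all are continuous)
  have hWj : ContDiff ℝ 1 (uncurry (revisedProfile R U₀)) := contDiff_uncurry_revisedProfile hU hR
  have hwj : ContDiff ℝ 1 (uncurry w) := by
    have e : uncurry w = uncurry (revisedProfile R U₀) -
        uncurry fun s y => cutoffScaled R y • U₀ s y := by
      funext p
      simp only [hw, uncurry_def, Pi.sub_apply, revisedProfile_apply]
      abel
    rw [e]
    exact hWj.sub (contDiff_cutoffScaled_smul hU R)
  have hUc : Continuous (U₀ s) := (contDiff_profileSlice hU s).continuous
  have hDUc : Continuous (fderiv ℝ (U₀ s)) :=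
    (contDiff_profileSlice hU s).continuous_fderiv one_ne_zero
  have hwc : Continuous (w s) := (contDiff_profileSlice hwj s).continuous
  have hDwc : Continuous (fderiv ℝ (w s)) :=
    (contDiff_profileSlice hwj s).continuous_fderiv one_ne_zero
  have hwtc : Continuous (timeDeriv w s) := by
    have e : timeDeriv w s = fun y => fderiv ℝ (uncurry w) (s, y) (1, 0) :=
      funext fun y => timeDeriv_profile hwj s y
    rw [e]
    exact ((hwj.continuous_fderiv one_ne_zero).clm_apply continuous_const).comp
      (continuous_const.prodMk continuous_id)
  have hdξc : Continuous (fderiv ℝ (cutoffScaled R)) := continuous_fderiv_cutoffScaled R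
  have hζc : Continuous ζ := hζ.contDiff.continuous
  have hζ1 : ContDiff ℝ 1 ζ := hζ.contDiff.of_le (mod_cast le_top)
  have hDζc : ∀ i, Continuous fun y => fderiv ℝ ζ y (b i) := fun i =>
    (hζ.contDiff.continuous_fderiv (by simp)).clm_apply continuous_const
  -- the `L²` bounds of the two remainder fields
  set F₁ : EuclideanSpace ℝ (Fin 3) → EuclideanSpace ℝ (Fin 3) := fun y =>
    (fderiv ℝ (cutoffScaled R) y y) • U₀ s y + fderiv ℝ (w s) y y +
      ∑ i, (fderiv ℝ (cutoffScaled R) y (b i)) • fderiv ℝ (U₀ s) y (b i) with hF₁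
  have hF₁c : Continuous F₁ :=
    (((hdξc.clm_apply continuous_id).smul hUc).add (hDwc.clm_apply continuous_id)).add
      (continuous_finsetSum _ fun i _ =>
        (hdξc.clm_apply continuous_const).smul (hDUc.clm_apply continuous_const))
  have hF₁b : eLpNorm F₁ 2 volume ≤ ENNReal.ofReal (K₁ * Bρ) := by
    refine (eLpNorm_le_of_norm_le_mul hK₁ h₁ 2).trans ?_
    rw [ENNReal.ofReal_mul hK₁]
    exact mul_le_mul' le_rfl hρ
  set F : EuclideanSpace ℝ (Fin 3) → EuclideanSpace ℝ (Fin 3) := fun y =>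
    timeDeriv w s y - w s y - F₁ y with hF
  have hFm : AEStronglyMeasurable F volume := ((hwtc.sub hwc).sub hF₁c).aestronglyMeasurable
  have hFb : eLpNorm F 2 volume ≤ ENNReal.ofReal (Bt + Bw + K₁ * Bρ) := by
    have h1 : eLpNorm F 2 volume ≤ eLpNorm (fun y => timeDeriv w s y - w s y) 2 volume +
        eLpNorm F₁ 2 volume :=
      eLpNorm_sub_le (hwtc.sub hwc).aestronglyMeasurable hF₁c.aestronglyMeasurable one_le_two
    have h2 : eLpNorm (fun y => timeDeriv w s y - w s y) 2 volume ≤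
        eLpNorm (timeDeriv w s) 2 volume + eLpNorm (w s) 2 volume :=
      eLpNorm_sub_le hwtc.aestronglyMeasurable hwc.aestronglyMeasurable one_le_two
    calc eLpNorm F 2 volume ≤ ENNReal.ofReal Bt + ENNReal.ofReal Bw + ENNReal.ofReal (K₁ * Bρ) :=
          h1.trans (add_le_add (h2.trans (add_le_add h_t h_w)) hF₁b)
      _ = ENNReal.ofReal (Bt + Bw + K₁ * Bρ) := by
          rw [← ENNReal.ofReal_add hBt hBw, ← ENNReal.ofReal_add (by positivity) (by positivity)]
  set H : Fin (Module.finrank ℝ (EuclideanSpace ℝ (Fin 3))) → EuclideanSpace ℝ (Fin 3) →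
      EuclideanSpace ℝ (Fin 3) := fun i y =>
    (fderiv ℝ (cutoffScaled R) y (b i)) • U₀ s y + fderiv ℝ (w s) y (b i) with hH
  have hHm : ∀ i, AEStronglyMeasurable (H i) volume := fun i =>
    (((hdξc.clm_apply continuous_const).smul hUc).add
      (hDwc.clm_apply continuous_const)).aestronglyMeasurable
  have hHb : ∀ i, eLpNorm (H i) 2 volume ≤ ENNReal.ofReal (K₂ * Bρ) := fun i => by
    refine (eLpNorm_le_of_norm_le_mul hK₂ (h₂ i) 2).trans ?_
    rw [ENNReal.ofReal_mul hK₂]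
    exact mul_le_mul' le_rfl hρ
  -- Cauchy–Schwarz on each pairing
  have e1 : (fun y => timeDeriv w s y - w s y - (fderiv ℝ (cutoffScaled R) y y) • U₀ s y -
      fderiv ℝ (w s) y y - ∑ i, (fderiv ℝ (cutoffScaled R) y (b i)) • fderiv ℝ (U₀ s) y (b i)) =
      F := by
    funext y
    simp only [hF, hF₁]
    abel
  have hmain : |∫ y, ⟪F y, ζ y⟫| ≤ (Bt + Bw + K₁ * Bρ) * Real.sqrt (∫ y, ‖ζ y‖ ^ 2) :=
    abs_integral_inner_le_of_eLpNorm_le hFm (by positivity) hFb hζc hζ.hasCompactSupport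
  have hgrad : ∀ i, |∫ y, ⟪H i y, fderiv ℝ ζ y (b i)⟫| ≤
      K₂ * Bρ * Real.sqrt (∫ y, ‖fderiv ℝ ζ y (b i)‖ ^ 2) := fun i =>
    abs_integral_inner_le_of_eLpNorm_le (hHm i) (by positivity) (hHb i) (hDζc i)
      (hζ.hasCompactSupport.fderiv_apply (𝕜 := ℝ) (b i))
  have hs1 := sqrt_integral_norm_sq_le_h1Norm ζ
  have hs2 : ∀ i, Real.sqrt (∫ y, ‖fderiv ℝ ζ y (b i)‖ ^ 2) ≤ h1Norm ζ := fun i =>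
    sqrt_integral_norm_fderiv_apply_sq_le_h1Norm hζ1 hζ.hasCompactSupport i
  have hh1 : 0 ≤ h1Norm ζ := Real.sqrt_nonneg _
  have hcard : (Finset.univ : Finset (Fin (Module.finrank ℝ (EuclideanSpace ℝ (Fin 3))))).card =
      3 := by
    rw [Finset.card_univ, Fintype.card_fin, finrank_euclideanSpace_fin]
  have hF_eq : (fun y => ⟪timeDeriv w s y - w s y -
      (fderiv ℝ (cutoffScaled R) y y) • U₀ s y - fderiv ℝ (w s) y y -
      ∑ i, (fderiv ℝ (cutoffScaled R) y (b i)) • fderiv ℝ (U₀ s) y (b i), ζ y⟫) =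
      fun y => ⟪F y, ζ y⟫ := by
    funext y
    rw [← e1]
  rw [hF_eq]
  calc |(∫ y, ⟪F y, ζ y⟫) + ∑ i, ∫ y, ⟪H i y, fderiv ℝ ζ y (b i)⟫|
      ≤ |∫ y, ⟪F y, ζ y⟫| + ∑ i, |∫ y, ⟪H i y, fderiv ℝ ζ y (b i)⟫| :=
        (abs_add_le _ _).trans (add_le_add le_rfl (Finset.abs_sum_le_sum_abs _ _))
    _ ≤ (Bt + Bw + K₁ * Bρ) * h1Norm ζ + ∑ _i : Fin (Module.finrank ℝ
          (EuclideanSpace ℝ (Fin 3))), K₂ * Bρ * h1Norm ζ := by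
        refine add_le_add (hmain.trans (mul_le_mul_of_nonneg_left hs1 (by positivity)))
          (Finset.sum_le_sum fun i _ => (hgrad i).trans
            (mul_le_mul_of_nonneg_left (hs2 i) (by positivity)))
    _ = (Bt + Bw + K₁ * Bρ + 3 * (K₂ * Bρ)) * h1Norm ζ := by
        rw [Finset.sum_const, hcard, nsmul_eq_mul]
        push_cast
        ring

end BradshawTsai2017

end Literature.Analysis.FluidPDE

end
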